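import Summits.Ventures.PercRepro.Night2LocalDQm1Zero

/-!
# PercRepro — the regime `|E ∖ G| = q − 1` on COLOOP-FREE flats, every `q`: the structure forced by a loss (night-2, gen 12)

Sequel of `Night2LocalDQm1Zero.lean` (`M` loopless simple, `G` a rank-`(q+1)` flat with `|E ∖ G| = q − 1`, `M|G` coloop-free):
a loss at a covering set means `L1 > 1`, which needs `q + 1` preimages (`add_one_le_card_coloops_of_one_lt_L1`), so the
covering set is an independent `(q+1)`-set (`indep_of_add_one_le_card_coloops`) and a shadow set carrying layer-2 weight has
exactly `q + 2` elements (`card_eq_add_two_of_mem_ex2`); deleting a non-coloop of such a set leaves an independent set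
(`indep_erase_of_not_coloop_gen`); the coloops of `S` lie in every member carrying layer-2 weight
(`mem_of_mem_ex2_of_mem_coloops_gen`); `G ∖ S ≠ ∅` (`exists_mem_sdiff_of_mem_ex2_gen`).  The fat-pair count and the cell
(THEOREM F) are in `Night2LocalDQm1ZeroFat.lean`.  Paper: `proofs/NIGHT-2-dq3.md` §6.
-/

open scoped Matroid

namespace PercRepro.Shadow

open Finset PerFlat ThmH

variable {α : Type*} [DecidableEq α] {M : Matroid α} [M.Finite]

section Structure

variable {q : ℕ} {G S : Finset α}

open scoped Classical in
/-- At `d = q − 1`: `L1 S > 1` forces at least `q + 1` coloops of `S`. -/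
theorem add_one_le_card_coloops_of_one_lt_L1 (hG : G ∈ flatsQ M (q + 1)) {d : ℕ} (hd : (gr M \ G).card = d)
    (hdq : d + 1 = q) (S : Finset α) (h : 1 < L1 M q G S) : q + 1 ≤ (coloops M S).card := by
  by_contra hlt
  push Not at hlt
  have hL := L1_le_coloops_mul hG hd (by omega) S
  rw [phiQ_div_two_add_pred hdq] at hL
  have hq1 : (0 : ℚ) < (q : ℚ) + 1 := by positivity
  have hq : ((coloops M S).card : ℚ) ≤ (q : ℚ) := by exact_mod_cast (by omega : (coloops M S).card ≤ q)
  have hphi : phiQ q / ((q : ℚ) + 1) = ((q : ℚ) + 2) / (((q : ℚ) + 1) ^ 2) := by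
    unfold phiQ; field_simp
  rw [hphi] at hL
  have hpos : (0 : ℚ) ≤ ((q : ℚ) + 2) / (((q : ℚ) + 1) ^ 2) := by positivity
  have h2 : ((coloops M S).card : ℚ) * (((q : ℚ) + 2) / (((q : ℚ) + 1) ^ 2)) ≤
      (q : ℚ) * (((q : ℚ) + 2) / (((q : ℚ) + 1) ^ 2)) := mul_le_mul_of_nonneg_right hq hpos
  have h3 : (q : ℚ) * (((q : ℚ) + 2) / (((q : ℚ) + 1) ^ 2)) < 1 := by
    rw [mul_div_assoc', div_lt_one (by positivity)]
    nlinarith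
  linarith

open scoped Classical in
/-- A shadow set with at least `q + 1` coloops is independent with `q + 1` elements (loopless `M`). -/
theorem indep_of_add_one_le_card_coloops (hl : ∀ e ∈ gr M, M.Indep {e}) (hG : G ∈ flatsQ M (q + 1))
    (hS : S ∈ shadowAt M (q + 2) q (Uq M (q + 2) q) G) (h5 : q + 1 ≤ (coloops M S).card) :
    M.Indep (S : Set α) ∧ S.card = q + 1 := by
  have hSG : S ⊆ G := subset_of_mem_shadowAt hS
  have hSg : S ⊆ gr M := hSG.trans (mem_flatsQ.1 hG).1
  have hr : rkN M S = q + 1 := rkN_eq_of_mem_shadowAt hS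
  have hadd := rkN_nonColoops_add (M := M) (S := S) hSg
  have hzero : rkN M (nonColoops M S) = 0 := by omega
  have hnl : ∀ e ∈ gr M, M.IsNonloop e := fun e he => Matroid.indep_singleton.1 (hl e he)
  have hnsub : nonColoops M S ⊆ gr M := by
    unfold nonColoops; exact Finset.sdiff_subset.trans hSg
  have hempty : nonColoops M S = ∅ := eq_empty_of_rkN_eq_zero hnl hnsub hzero
  have hsub : S ⊆ coloops M S := by
    intro x hx
    by_contra hxc
    have hmem : x ∈ nonColoops M S := by unfold nonColoops; exact Finset.mem_sdiff.2 ⟨hx, hxc⟩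
    rw [hempty] at hmem
    exact Finset.notMem_empty x hmem
  have heq : coloops M S = S := Finset.Subset.antisymm (coloops_subset_self S) hsub
  have hind : M.Indep (S : Set α) := by rw [← heq]; exact indep_coloops hSg
  refine ⟨hind, ?_⟩
  have := rkN_eq_card_of_indep hind
  omega

open scoped Classical in
/-- Without coloops of `M|G` at `d = q − 1`: a shadow set carrying layer-2 weight has exactly `q + 2` elements. -/
theorem card_eq_add_two_of_mem_ex2 (hl : ∀ e ∈ gr M, M.Indep {e}) (hG : G ∈ flatsQ M (q + 1)) {d : ℕ}
    (hd : (gr M \ G).card = d) (hdq : d + 1 = q) (hk : kColoops M G = 0) {B : Finset α}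
    (hB : B ∈ ex2 M q G S) : S.card = q + 2 := by
  obtain ⟨z, hz, hloss⟩ := exists_loss_ne_zero_of_mem_ex2 hB
  obtain ⟨hBm, -, hBS, hsub, hcard⟩ := mem_ex2_unpack hB
  have hL := one_lt_L1_of_loss_ne_zero hk hloss
  have h5 := add_one_le_card_coloops_of_one_lt_L1 hG hd hdq _ hL
  have hS' : insert z B ∈ shadowAt M (q + 2) q (Uq M (q + 2) q) G :=
    insert_mem_shadowAt (Finset.Subset.refl _) hG hBm (hsub hz)
  obtain ⟨-, hc5⟩ := indep_of_add_one_le_card_coloops hl hG hS' h5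
  have hzB : z ∉ B := (Finset.mem_sdiff.1 hz).2
  rw [Finset.card_insert_of_notMem hzB] at hc5
  have := Finset.card_sdiff_add_card_eq_card hBS
  omega

open scoped Classical in
/-- In a `(q+2)`-element shadow set, deleting a non-coloop leaves an independent set. -/
theorem indep_erase_of_not_coloop_gen (hG : G ∈ flatsQ M (q + 1))
    (hS : S ∈ shadowAt M (q + 2) q (Uq M (q + 2) q) G) (hS6 : S.card = q + 2) {t : α} (ht : t ∈ S)
    (htc : t ∉ coloops M S) : M.Indep ((S.erase t : Finset α) : Set α) := by
  have hSg : S ⊆ gr M := (subset_of_mem_shadowAt hS).trans (mem_flatsQ.1 hG).1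
  have hr : rkN M S = q + 1 := rkN_eq_of_mem_shadowAt hS
  have hcl : t ∈ clF M (S.erase t) := by
    by_contra h
    exact htc (mem_coloops.2 ⟨ht, h⟩)
  have h1 : rkN M (insert t (S.erase t)) ≤ rkN M (S.erase t) :=
    rkN_insert_le_of_mem_clF ((Finset.erase_subset t S).trans hSg) hcl
  rw [Finset.insert_erase ht] at h1
  have h2 : rkN M (S.erase t) ≤ rkN M S := rkN_mono (Finset.erase_subset t S)
  apply indep_of_rkN_eq_card
  rw [Finset.card_erase_of_mem ht, hS6]
  omega

open scoped Classical in
/-- A coloop of `S` lies in every member carrying layer-2 weight at `S` (every `q`). -/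
theorem mem_of_mem_ex2_of_mem_coloops_gen (hG : G ∈ flatsQ M (q + 1))
    (hS : S ∈ shadowAt M (q + 2) q (Uq M (q + 2) q) G) {B : Finset α} (hB : B ∈ ex2 M q G S) {t : α}
    (ht : t ∈ coloops M S) : t ∈ B := by
  by_contra htB
  obtain ⟨hBm, -, hBS, hsub, hcard⟩ := mem_ex2_unpack hB
  have hSg : S ⊆ gr M := (subset_of_mem_shadowAt hS).trans (mem_flatsQ.1 hG).1
  have htS : t ∈ S := (mem_coloops.1 ht).1
  have htSB : t ∈ S \ B := Finset.mem_sdiff.2 ⟨htS, htB⟩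
  obtain ⟨z', hz'SB, hz't⟩ : ∃ z' ∈ S \ B, z' ≠ t := by
    by_contra hno
    push Not at hno
    have hsub1 : S \ B ⊆ {t} := fun x hx => Finset.mem_singleton.2 (hno x hx)
    have := Finset.card_le_card hsub1
    rw [Finset.card_singleton] at this
    omega
  have hz'cl : z' ∈ G \ clF M B := hsub hz'SB
  have hsub2 : insert z' B ⊆ S.erase t := by
    intro x hx
    rw [Finset.mem_insert] at hx
    rw [Finset.mem_erase]
    rcases hx with rfl | hxB
    · exact ⟨hz't, (Finset.mem_sdiff.1 hz'SB).1⟩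
    · refine ⟨?_, hBS hxB⟩
      rintro rfl
      exact htB hxB
  have hBU : B ∈ Uq M (q + 2) q := (mem_membersIn.1 hBm).1
  have hrB : rkN M B = q := by
    have h := (mem_Uq.1 hBU).2.1
    rw [eRk_eq_rkN] at h
    exact_mod_cast h
  have hz'E : z' ∈ M.E \ M.closure (B : Set α) := by
    refine ⟨?_, ?_⟩
    · rw [← coe_gr]; exact_mod_cast (mem_flatsQ.1 hG).1 (Finset.mem_sdiff.1 hz'cl).1
    · intro h
      apply (Finset.mem_sdiff.1 hz'cl).2
      rw [← Finset.mem_coe, coe_clF]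
      exact h
  have h5 : rkN M (insert z' B) = q + 1 := by
    have h := Matroid.eRk_insert_eq_add_one hz'E
    rw [← Finset.coe_insert, eRk_eq_rkN, eRk_eq_rkN, hrB] at h
    exact_mod_cast h
  have hr : rkN M S = q + 1 := rkN_eq_of_mem_shadowAt hS
  have hdrop := rkN_erase_of_mem_coloops hSg ht
  have hmono := rkN_mono (M := M) hsub2
  omega

open scoped Classical in
/-- A member carrying layer-2 weight at `S` leaves a point of `G` outside `S` (`|E ∖ G| ≤ q − 1`). -/
theorem exists_mem_sdiff_of_mem_ex2_gen (hG : G ∈ flatsQ M (q + 1)) {d : ℕ} (hd : (gr M \ G).card = d)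
    (hdq : d + 1 = q) (hS : S ∈ shadowAt M (q + 2) q (Uq M (q + 2) q) G) {B : Finset α}
    (hB : B ∈ ex2 M q G S) : ∃ p ∈ G, p ∉ S := by
  obtain ⟨hBm, -, hBS, -, hcard⟩ := mem_ex2_unpack hB
  have hSG : S ⊆ G := subset_of_mem_shadowAt hS
  have hGg : G ⊆ gr M := (mem_flatsQ.1 hG).1
  have hBU : B ∈ Uq M (q + 2) q := (mem_membersIn.1 hBm).1
  have hr6 : rkN M (gr M \ B) = q + 2 := by
    have h := (mem_Uq.1 hBU).2.2
    rw [eRk_eq_rkN] at h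
    exact_mod_cast h
  have hc6 : q + 2 ≤ (gr M \ B).card := hr6 ▸ rkN_le_card _
  have hBG : B ⊆ G := hBS.trans hSG
  have hGg' : (gr M \ G).card + G.card = (gr M).card := Finset.card_sdiff_add_card_eq_card hGg
  have hBG' : (G \ B).card + B.card = G.card := Finset.card_sdiff_add_card_eq_card hBG
  have hBgr : (gr M \ B).card + B.card = (gr M).card := Finset.card_sdiff_add_card_eq_card (hBG.trans hGg)
  have hSG' : (G \ S).card + S.card = G.card := Finset.card_sdiff_add_card_eq_card hSG
  have hBS' : (S \ B).card + B.card = S.card := Finset.card_sdiff_add_card_eq_card hBS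
  have hpos : 0 < (G \ S).card := by omega
  obtain ⟨p, hp⟩ := Finset.card_pos.1 hpos
  exact ⟨p, (Finset.mem_sdiff.1 hp).1, (Finset.mem_sdiff.1 hp).2⟩

end Structure

end PercRepro.Shadow
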